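import Literature.Probability.Percolation.SharpnessDCTProofs
import Literature.Probability.Percolation.PlanarDuality
import Literature.Probability.Percolation.RSW
import HarnessLib

/-!
# Crux `PercNonProliferation.NonProliferation` (stmt-CriticalPhenomena-4444), line `avoidance-cost-covering` — stub `stub_shellOfBoxCrossers`

Helper file for the lead's skeleton of line `avoidance-cost-covering`
(`Cruxes/NonProliferation/Lines/avoidance_cost_covering.lean`): the deterministic bridge from the BOX
multi-crosser event (the socket's event of `nonProliferation_of_frequently_multiCross`) to the SHELL
multi-crosser event of the closed shell `Sh(m, L) := {v ∈ B(L) | ∃ l, m ≤ |v l|}`. Proves the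
registered stub signature `stub_shellOfBoxCrossers`; lands with `--supports stmt-CriticalPhenomena-4444`.

Last-visit surgery on open lattice paths (every `d`, `r`, `m ≤ L`, lattice configurations
`ω ⊆ E(ℤ^d)`):

* `exists_walk_of_mem_openConnIn` turns `{x i ↔ y i in B(L)}` into a `zdGraph`-walk inside `B(L)` with
  open edges; reversing it, `exists_firstHit` (induction on the walk from the OUTER end `y i`) stops at
  the FIRST vertex `u i ∈ B(m)` — the last visit of the original path to `B(m)`. The segment before the
  stop avoids `B(m)`, so each of its vertices has a coordinate of modulus `≥ m + 1`, and one lattice step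
  moves every coordinate by `≤ 1` (`DCT16.abs_sub_le_one_of_adj`), so the stopping vertex still has a
  coordinate of modulus `≥ m`: the whole segment lies in `Sh(m, L)`; the start `y i ∈ ∂ⁱⁿB(L)` has a
  coordinate `±L` (`exists_eq_of_mem_innerBoundary_box`) and `L ≥ m`.
* Distinctness is inherited: `Sh(m, L) ⊆ B(L)` (`openConnIn_mono`) and `x i ↔ u i`, `u j ↔ x j` inside
  `B(L)` (the other segment), so `u i ↔ u j` inside the shell would join `x i` to `x j` inside `B(L)`.
-/

namespace Summit.CriticalPhenomena.PercolationContinuityZ3.Theorems.NonProliferation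

open Literature.Probability.LatticeModels Literature.Probability.Percolation

namespace StubShellOfBoxCrossers

/-- **First hit of `B(m)` from the outer end.** For a lattice walk `w : v → u` inside `B(L)` with open
edges, started at a point `v` of the shell `Sh(m, L)` and ending in `B(m)`, there is a point
`u' ∈ B(m)` joined to `v` by an open path inside `Sh(m, L)` and to `u` by an open path inside `B(L)`
(stop at the first vertex of `w` in `B(m)`). -/
theorem exists_firstHit {d m L : ℕ} {ω : BondConfig (Site d)} :
    ∀ {v u : Site d} (w : (zdGraph d).Walk v u), (∀ z ∈ w.support, z ∈ (↑(box d L) : Set (Site d))) →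
      (∀ e ∈ w.edges, e ∈ ω) → v ∈ {v : Site d | v ∈ box d L ∧ ∃ l : Fin d, (m : ℤ) ≤ |v l|} →
      u ∈ box d m →
      ∃ u' ∈ box d m, ω ∈ openConnIn {v : Site d | v ∈ box d L ∧ ∃ l : Fin d, (m : ℤ) ≤ |v l|} v u' ∧
        ω ∈ openConnIn (↑(box d L) : Set (Site d)) u' u := by
  intro v u w
  induction w with
  | nil =>
    intro _ _ hv hu
    exact ⟨_, hu, openConnIn_refl hv, openConnIn_refl (Finset.mem_coe.2 hv.1)⟩
  | @cons a b c hab w ih =>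
    intro hsupp hedges ha hc
    by_cases ham : a ∈ box d m
    · exact ⟨a, ham, openConnIn_refl ha, mem_openConnIn_of_walk (SimpleGraph.Walk.cons hab w) hsupp hedges⟩
    · have hbL : b ∈ box d L := Finset.mem_coe.1 (hsupp b (by simp))
      have hb : b ∈ {v : Site d | v ∈ box d L ∧ ∃ l : Fin d, (m : ℤ) ≤ |v l|} := by
        refine ⟨hbL, ?_⟩
        rw [mem_box, not_forall] at ham
        obtain ⟨l, hl⟩ := ham
        refine ⟨l, ?_⟩
        have h1 := DCT16.abs_sub_le_one_of_adj hab l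
        rw [abs_le] at h1
        rw [le_abs]
        omega
      obtain ⟨u', hu', h1, h2⟩ :=
        ih (fun z hz => hsupp z (by simp [hz])) (fun e he => hedges e (by simp [he])) hb hc
      have hedge : s(a, b) ∈ ω := hedges s(a, b) (by simp)
      exact ⟨u', hu', PlanarDuality.openConnIn_trans (openConnIn_of_adj ha hb hedge hab.ne) h1, h2⟩

/-- **Last-visit surgery.** If `u ∈ B(m)` is joined inside `B(L)` (`m ≤ L`) to a point `y` of the sphere
`∂ⁱⁿB(L)` by an open path of a lattice configuration, then some `u' ∈ B(m)` (the last visit of the path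
to `B(m)`) is joined to `u` inside `B(L)` and to `y` inside the shell `Sh(m, L)`. -/
theorem exists_lastVisit {d m L : ℕ} {ω : BondConfig (Site d)} (hmL : m ≤ L)
    (hω : ω ⊆ (zdGraph d).edgeSet) {u y : Site d} (hu : u ∈ box d m)
    (hy : y ∈ innerBoundary (zdGraph d) (box d L))
    (h : ω ∈ openConnIn (↑(box d L) : Set (Site d)) u y) :
    ∃ u' ∈ box d m, ω ∈ openConnIn (↑(box d L) : Set (Site d)) u u' ∧
      ω ∈ openConnIn {v : Site d | v ∈ box d L ∧ ∃ l : Fin d, (m : ℤ) ≤ |v l|} u' y := by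
  obtain ⟨p, hpS, hpω⟩ := exists_walk_of_mem_openConnIn hω h
  have hyS : y ∈ {v : Site d | v ∈ box d L ∧ ∃ l : Fin d, (m : ℤ) ≤ |v l|} := by
    refine ⟨(mem_innerBoundary_iff.1 hy).1, ?_⟩
    obtain ⟨i, hi⟩ := exists_eq_of_mem_innerBoundary_box hy
    refine ⟨i, ?_⟩
    rw [le_abs]
    omega
  obtain ⟨u', hu', h1, h2⟩ := exists_firstHit p.reverse
    (fun z hz => hpS z (by rwa [SimpleGraph.Walk.support_reverse, List.mem_reverse] at hz))
    (fun e he => hpω e (by rwa [SimpleGraph.Walk.edges_reverse, List.mem_reverse] at he)) hyS hu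
  refine ⟨u', hu', ?_, ?_⟩
  · rw [openConnIn_comm]; exact h2
  · rw [openConnIn_comm]; exact h1

end StubShellOfBoxCrossers

/-- Registered stub `stub_shellOfBoxCrossers` of line `avoidance-cost-covering` (deterministic last-visit
surgery, every `d`, `r`, `m ≤ L`, lattice configurations): `r+1` box-distinct crossers of `B(L) ∖ B(m)`
(the socket's event) give `r+1` shell-distinct crossers of `Sh(m, L)` — replace each representative
`x i ∈ B(m)` by the LAST point `u i` of its crossing path in `B(m)` (the suffix lies in `Sh(m, L)`); two
suffix representatives joined inside `Sh(m, L) ⊆ B(L)` would join `x i` to `x j` inside `B(L)`. -/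
theorem stub_shellOfBoxCrossers :
    ∀ (d r m L : ℕ) (ω : BondConfig (Site d)), m ≤ L → ω ⊆ (zdGraph d).edgeSet →
    ω ∈ {ω | ∃ x : Fin (r + 1) → Site d, (∀ i, x i ∈ box d m) ∧
      (∀ i, ∃ y ∈ innerBoundary (zdGraph d) (box d L),
        ω ∈ openConnIn (↑(box d L) : Set (Site d)) (x i) y) ∧
      ∀ i j, i ≠ j → ω ∉ openConnIn (↑(box d L) : Set (Site d)) (x i) (x j)} →
    ω ∈ {ω | ∃ x : Fin (r + 1) → Site d, (∀ i, x i ∈ box d m) ∧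
      (∀ i, ∃ y ∈ innerBoundary (zdGraph d) (box d L),
        ω ∈ openConnIn {v : Site d | v ∈ box d L ∧ ∃ l : Fin d, (m : ℤ) ≤ |v l|} (x i) y) ∧
      ∀ i j, i ≠ j → ω ∉ openConnIn {v : Site d | v ∈ box d L ∧ ∃ l : Fin d, (m : ℤ) ≤ |v l|} (x i) (x j)} := by
  intro d r m L ω hmL hω hbox
  obtain ⟨x, hxm, hconn, hdisj⟩ := hbox
  choose y hy hxy using hconn
  have key : ∀ i, ∃ u' ∈ box d m, ω ∈ openConnIn (↑(box d L) : Set (Site d)) (x i) u' ∧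
      ω ∈ openConnIn {v : Site d | v ∈ box d L ∧ ∃ l : Fin d, (m : ℤ) ≤ |v l|} u' (y i) :=
    fun i => StubShellOfBoxCrossers.exists_lastVisit hmL hω (hxm i) (hy i) (hxy i)
  choose u hu hxu huy using key
  refine ⟨u, hu, fun i => ⟨y i, hy i, huy i⟩, ?_⟩
  intro i j hij hij'
  apply hdisj i j hij
  have h1 : ω ∈ openConnIn (↑(box d L) : Set (Site d)) (u i) (u j) :=
    openConnIn_mono (fun v hv => Finset.mem_coe.2 hv.1) _ _ hij'
  have h2 : ω ∈ openConnIn (↑(box d L) : Set (Site d)) (u j) (x j) := by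
    rw [openConnIn_comm]; exact hxu j
  exact PlanarDuality.openConnIn_trans (hxu i) (PlanarDuality.openConnIn_trans h1 h2)

end Summit.CriticalPhenomena.PercolationContinuityZ3.Theorems.NonProliferation
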